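import Mathlib
import HarnessLib
import Summits.ValiantsHypothesis.ValiantsHypothesis.Theses.MonotoneRestoration
import Literature.Computability.AlgebraicComplexity.ArithCircuit
import Literature.Computability.AlgebraicComplexity.ArithCircuitProofs
import Literature.Computability.AlgebraicComplexity.MonotoneStructure
import Literature.Computability.AlgebraicComplexity.PermanentIrreducible
import Literature.ModelTheory.FiniteModelTheory.CkEquiv
import Summits.ValiantsHypothesis.ValiantsHypothesis.Theorems.MonotoneRestorationMonotoneRestorationQPCosetCount
import Summits.ValiantsHypothesis.ValiantsHypothesis.Theorems.MonotoneRestorationMonotoneRestorationQPSymmetricLB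
import Summits.ValiantsHypothesis.ValiantsHypothesis.Theorems.MonotoneRestorationMonotoneRestorationQPSupportSymmetrisation
import Summits.ValiantsHypothesis.ValiantsHypothesis.Theorems.MonotoneRestorationMonotoneRestorationQPSparseRegime
import Summits.ValiantsHypothesis.ValiantsHypothesis.Theorems.MonotoneRestorationMonotoneRestorationQPBeta
import Literature.Computability.AlgebraicComplexity.SymmetricArithCircuit
import Literature.Computability.AlgebraicComplexity.DawarWilsenach2025Proofs
import Literature.GroupTheory.PermutationGroups.SmallIndexSubgroups
import Summits.ValiantsHypothesis.ValiantsHypothesis.Theorems.MonotoneRestorationQP.Negative.LoadBearing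
import Summits.ValiantsHypothesis.ValiantsHypothesis.Theorems.MonotoneRestorationMonotoneRestorationQPPermSupportCount

/-! TTRL-lite variant V18996 of stmt-ValiantsHypothesis-15886

Variant `lemma_proposal` (transport `Alt(Ω) → A_X`, `Ω = complement of X`) of stub
`stub_altFixing_orbit_dichotomy` (crux `MonotoneRestorationQP`, route MonotoneRestoration): the identity
extension `Equiv.Perm.ofSubtype g` of a permutation `g` of `{x // x ∉ X}` fixes `X` pointwise and has the
sign of `g` (`Equiv.Perm.ofSubtype_apply_of_not_mem`, `Equiv.Perm.sign_ofSubtype`).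
-/

set_option linter.dupNamespace false

namespace Summit.ValiantsHypothesis.ValiantsHypothesis.Theorems

open Summit.ValiantsHypothesis.ValiantsHypothesis.Theses.MonotoneRestoration
open Literature.Computability.AlgebraicComplexity

/-- TTRL-lite variant V18996 (`lemma_proposal`) of `stub_altFixing_orbit_dichotomy`: for a finset
`X ⊆ Fin n` and a permutation `g` of the complement subtype `{x // x ∉ X}`, the identity extension
`Equiv.Perm.ofSubtype g : Perm (Fin n)` fixes every point of `X` and `sign (ofSubtype g) = sign g`. -/
theorem stub_altFixing_orbit_dichotomy_var18996 :
    ∀ (n : ℕ) (X : Finset (Fin n)) (g : Equiv.Perm {x : Fin n // x ∉ X}), (∀ x ∈ X, Equiv.Perm.ofSubtype g x = x) ∧ Equiv.Perm.sign (Equiv.Perm.ofSubtype g) = Equiv.Perm.sign g := by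
  intro n X g
  refine ⟨fun x hx => ?_, ?_⟩
  · exact Equiv.Perm.ofSubtype_apply_of_not_mem g (fun h => h hx)
  · exact Equiv.Perm.sign_ofSubtype g

end Summit.ValiantsHypothesis.ValiantsHypothesis.Theorems
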